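import Mathlib.Geometry.Manifold.ContMDiff.Atlas
import Literature.Geometry.Conformal.Liouville
import Literature.Geometry.Conformal.MoebiusSphere
import Literature.Geometry.Conformal.MoebiusStereographic
import Literature.Geometry.Manifold.GStructureDevelopment
import Literature.Geometry.Riemannian.ConformallyFlatTransition
import Literature.Geometry.Riemannian.KuiperProofs
import HarnessLib

/-!
# Kuiper's theorem, proved: the developing map of a simply connected conformally flat manifold

Topic `Literature/Geometry/Riemannian`. This file discharges the named fact
`Literature.Geometry.Riemannian.kuiper_developingMap` (`KuiperProofs.lean`; Kuiper 1949, the development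
theorem) and with it `Literature.Geometry.Riemannian.kuiper` (`Kuiper.lean`; Kuiper 1949, Theorem p. 917 =
Besse 1987, Thm. 1.171: a compact simply connected conformally flat manifold is the sphere) and
its case `n = 4`, `Literature.Geometry.Riemannian.kuiper_conformallyFlat_sphere_four` (`PICSphereFacts.lean`):

* `Literature.Riemannian.kuiper_developingMap_holds : kuiper_developingMap`,
* `Literature.Riemannian.kuiper_holds : kuiper`,
* `Literature.Lorentz.kuiper_conformallyFlat_sphere_four_holds : kuiper_conformallyFlat_sphere_four`.

Everything is PROVED; the file asserts nothing.

## The printed proof and its formal counterpart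

Kuiper 1949 (the same route in Benedetti–Petronio 1992, §B.1, and Besse 1987, 1.171): let
`(M, g)` be simply connected and locally conformally flat, `dim M = n ≥ 3`.

1. *`M` is an `(Sⁿ, Möb(n))`-manifold.* Two conformally flat charts `φ, ψ` at `x` differ by
   `τ = ψ ∘ φ⁻¹`, a conformal diffeomorphism between domains of `ℝⁿ`
   (`IsConformallyFlatIn.exists_conformal_transition`, `ConformallyFlatTransition.lean`); by
   **Liouville's theorem** (`Literature.Geometry.Conformal.liouville`, `Conformal/Liouville.lean`;
   Benedetti–Petronio Thm. A.3.7) `τ` is a similarity or a similarity composed with an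
   inversion, hence (`Literature.Geometry.Conformal.exists_moebiusMaps_similarity`/`_inversion`,
   `Conformal/MoebiusStereographic.lean`) the restriction, under the inverse stereographic
   projection `σ⁻¹ : ℝⁿ → Sⁿ`, of a Möbius transformation of `Sⁿ` (an element of the
   orthochronous Lorentz group acting on the projectivised light cone,
   `Conformal/MoebiusSphere.lean`). This gives the `(Sⁿ, Möb(n))`-atlas `moebiusAtlas` with
   charts `σ⁻¹ ∘ φᵢ` (`Literature.Geometry.Manifold.GStructure.Atlas`, `Manifold/GStructureDevelopment.lean`).
2. *Development.* Möbius transformations are rigid (`Literature.Geometry.Conformal.moebiusMaps_rigid`), so the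
   monodromy argument (`Literature.Geometry.Manifold.GStructure.Atlas.exists_developingMap'`; Benedetti–Petronio
   Prop. B.1.3/B.1.17) produces `D : M → Sⁿ` which near every point is `γ ∘ σ⁻¹ ∘ φᵢ` with `γ`
   Möbius; as `φᵢ` is a local diffeomorphism, `σ⁻¹` a chart inverse and `γ` a diffeomorphism of
   `Sⁿ`, `D` is a `C^∞` local diffeomorphism (`exists_developingMap`). This is
   `kuiper_developingMap`.
3. *Compact case.* `KuiperProofs.lean` (proved there): a local diffeomorphism from a compact
   connected manifold to the simply connected `Sⁿ` is a diffeomorphism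
   (`kuiper_of_developingMap`), whence `kuiper_holds`.

The conformality of `D` (part of Kuiper's statement) is not recorded by the vendored facts and
is not needed for the diffeomorphism conclusion; positivity of `g` (`IsRiemannian`) is not used
either (local conformal flatness in the sense of `ConformallyFlat.lean` already forces it).

## References

* N. H. Kuiper, *On conformally-flat spaces in the large*, Ann. of Math. (2) 50 (1949) 916–924,
  Theorem p. 917 (development of simply connected conformally flat spaces into `Sⁿ`; the
  compact simply connected case is the sphere). Not held; locator as in `Kuiper.lean`.
* A. L. Besse, *Einstein Manifolds*, Springer 1987, 1.164 (definition), 1.171 (Kuiper's theorem;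
  PDF p. 151, read).
* R. Benedetti, C. Petronio, *Lectures on Hyperbolic Geometry*, Springer 1992 (read): Thm. A.3.7
  p. 21 (Liouville), §B.1 p. 45 (definition of an `(X, G)`-structure), Prop. B.1.3 p. 45 and
  Prop. B.1.17 p. 55 (developing function of a simply connected `(X, G)`-manifold).
-/

noncomputable section

open scoped Manifold ContDiff Topology RealInnerProductSpace
open Function Set Filter Module Metric Literature.Geometry.Riemannian Literature.Geometry.Lorentzian Literature.Geometry.Conformal

namespace Literature.Geometry.Riemannian

/-! ### Three facts about local diffeomorphisms -/

section LocalDiffeomorph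

variable {E : Type*} [NormedAddCommGroup E] [NormedSpace ℝ E] {H : Type*} [TopologicalSpace H]
  {I : ModelWithCorners ℝ E H} {M : Type*} [TopologicalSpace M] [ChartedSpace H M]
  {E' : Type*} [NormedAddCommGroup E'] [NormedSpace ℝ E'] {H' : Type*} [TopologicalSpace H']
  {J : ModelWithCorners ℝ E' H'} {N : Type*} [TopologicalSpace N] [ChartedSpace H' N] {m : ℕ∞ω}

/-- Restriction of a partial diffeomorphism to an open set (kept in the project namespace).
[folklore] -/
def PartialDiffeomorph.restrOpen (Φ : _root_.PartialDiffeomorph I J M N m) (s : Set M)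
    (hs : IsOpen s) : _root_.PartialDiffeomorph I J M N m where
  toPartialEquiv := Φ.toPartialEquiv.restr s
  open_source := (Φ.toOpenPartialHomeomorph.restrOpen s hs).open_source
  open_target := (Φ.toOpenPartialHomeomorph.restrOpen s hs).open_target
  contMDiffOn_toFun := Φ.contMDiffOn_toFun.mono inter_subset_left
  contMDiffOn_invFun := Φ.contMDiffOn_invFun.mono inter_subset_left

/-- Being a `C^m` local diffeomorphism at `x` only depends on the germ of the map at `x`.
[folklore] -/
theorem isLocalDiffeomorphAt_congr_of_eventuallyEq {f g : M → N} {x : M}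
    (hf : IsLocalDiffeomorphAt I J m f x) (h : g =ᶠ[𝓝 x] f) : IsLocalDiffeomorphAt I J m g x := by
  obtain ⟨Φ, hx, heq⟩ := hf
  obtain ⟨s, hs, hso, hxs⟩ := mem_nhds_iff.1 h
  refine ⟨PartialDiffeomorph.restrOpen Φ s hso, ⟨hx, hxs⟩, ?_⟩
  rintro y ⟨hy, hys⟩
  change g y = Φ y
  rw [hs hys, heq hy]

/-- The inverse of a chart of the atlas of a `C^m` manifold is a `C^m` local diffeomorphism
from the model space at every point of its target. [folklore] -/
theorem isLocalDiffeomorphAt_symm_of_mem_atlas [IsManifold I m M] {e : OpenPartialHomeomorph M H}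
    (he : e ∈ atlas H M) {y : H} (hy : y ∈ e.target) : IsLocalDiffeomorphAt I I m e.symm y :=
  let Φ : _root_.PartialDiffeomorph I I H M m :=
    { toPartialEquiv := e.symm.toPartialEquiv
      open_source := e.open_target
      open_target := e.open_source
      contMDiffOn_toFun := contMDiffOn_symm_of_mem_maximalAtlas (IsManifold.subset_maximalAtlas he)
      contMDiffOn_invFun := contMDiffOn_of_mem_maximalAtlas (IsManifold.subset_maximalAtlas he) }
  Φ.isLocalDiffeomorphAt _ _ _ hy

end LocalDiffeomorph

/-! ### The `(Sⁿ, Möb(n))`-atlas of a conformally flat manifold and its development -/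

section Development

variable {F : Type*} [NormedAddCommGroup F] [InnerProductSpace ℝ F] {n : ℕ}
  [Fact (finrank ℝ F = n + 1)]
  {M : Type*} [TopologicalSpace M] [ChartedSpace (EuclideanSpace ℝ (Fin n)) M]
  [IsManifold (𝓡 n) ∞ M]

/-- The inverse stereographic projection `ℝⁿ → Sⁿ ∖ {v}` (Mathlib's chart
`stereographic' n v`) is a `C^∞` local diffeomorphism at every point. [folklore] -/
theorem isLocalDiffeomorphAt_stereographic'_symm (v : sphere (0 : F) 1)
    (y : EuclideanSpace ℝ (Fin n)) :
    IsLocalDiffeomorphAt 𝓘(ℝ, EuclideanSpace ℝ (Fin n)) (𝓡 n) ∞ (stereographic' n v).symm y := by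
  have he : stereographic' n v ∈ atlas (EuclideanSpace ℝ (Fin n)) (sphere (0 : F) 1) := ⟨v, rfl⟩
  exact isLocalDiffeomorphAt_symm_of_mem_atlas (I := 𝓡 n) he (by simp)

/-- `map σ⁻¹ (𝓝 y) = 𝓝 (σ⁻¹ y)` for the inverse stereographic projection. [folklore] -/
theorem map_stereographic'_symm_nhds (v : sphere (0 : F) 1) (y : EuclideanSpace ℝ (Fin n)) :
    map (stereographic' n v).symm (𝓝 y) = 𝓝 ((stereographic' n v).symm y) :=
  (stereographic' n v).symm.map_nhds_eq (by simp)

variable {g : PseudoRiemannianMetric (𝓡 n) ∞ (EuclideanSpace ℝ (Fin n)) (TangentSpace (𝓡 n) : M → Type _)}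

/-- **A conformally flat manifold is an `(Sⁿ, Möb(n))`-manifold** (`n ≥ 3`; Kuiper 1949;
Benedetti–Petronio 1992, §B.1 p. 45 with Liouville's theorem A.3.7 p. 21). Given, for every `i : M`,
conformally flat coordinates `(φ i, u i)` for `g` at `i`, the maps `σ⁻¹ ∘ φ i : M → Sⁿ` (`σ` the
stereographic projection from `v`) on the open sets `{x | (φ i, u i) are conformally flat
coordinates at x}` form an `(Sⁿ, Möb(n))`-atlas (`Literature.Geometry.Manifold.GStructure.Atlas` for the set
`moebiusMaps F` of Möbius self-maps of the sphere): by `exists_conformal_transition` the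
transition maps are conformal, by Liouville's theorem (`Literature.Geometry.Conformal.liouville`) they are
similarities or similarities composed with an inversion, and these are Möbius under `σ⁻¹`
(`Literature.Geometry.Conformal.exists_moebiusMaps_similarity`/`exists_moebiusMaps_inversion`).
[cite: BenedettiPetronio1992, §B.1 p. 45 and Thm. A.3.7 p. 21] -/
def moebiusAtlas (hn : 3 ≤ n) (v : sphere (0 : F) 1) (φ : M → M → EuclideanSpace ℝ (Fin n))
    (u : M → M → ℝ) (hφ : ∀ i : M, g.IsConformallyFlatIn i (φ i) (u i)) :
    Manifold.GStructure.Atlas (moebiusMaps F) M M where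
  U i := {x | g.IsConformallyFlatIn x (φ i) (u i)}
  φ i := (stereographic' n v).symm ∘ φ i
  isOpen_U i := PseudoRiemannianMetric.isOpen_setOf_isConformallyFlatIn g (φ i) (u i)
  exists_mem x := ⟨x, hφ x⟩
  nhds_le i x hx := by
    obtain ⟨Φ, hxΦ, hΦ⟩ := hx.1
    have h1 : map (φ i) (𝓝 x) = 𝓝 (φ i x) := by
      rw [map_congr (eventuallyEq_of_mem (Φ.open_source.mem_nhds hxΦ) hΦ), hΦ hxΦ]
      exact Φ.toOpenPartialHomeomorph.map_nhds_eq hxΦ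
    rw [← Filter.map_map, h1, comp_apply, map_stereographic'_symm_nhds]
  compat i j x hxi hxj := by
    obtain ⟨U, τ, hUo, hUc, hxU, hτs, hτc, hτφ⟩ := hxi.exists_conformal_transition hxj
    have h3 : 3 ≤ finrank ℝ (EuclideanSpace ℝ (Fin n)) := by rwa [finrank_euclideanSpace_fin]
    -- near `x`, `φ i` takes values in `U` and `φ j = τ ∘ φ i`
    have hev : ∀ᶠ z in 𝓝 x, φ i z ∈ U ∧ τ (φ i z) = φ j z :=
      (hxi.1.contMDiffAt.continuousAt.eventually (hUo.mem_nhds hxU)).and hτφ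
    -- Liouville: `τ` is a similarity, or a similarity after an inversion with centre off `U`
    obtain ⟨c, A, b, hc, hform⟩ := liouville h3 hUo hUc hτs hτc
    obtain ⟨γ, hγ, hγσ⟩ := exists_moebiusMaps_similarity (F := F) v hc A b
    rcases hform with hsim | ⟨x₀, r, hx₀, hr, hinv⟩
    · refine ⟨γ, hγ, ?_⟩
      filter_upwards [hev] with z ⟨hzU, hzτ⟩
      simp only [comp_apply]
      rw [← hγσ, ← hzτ, hsim hzU]
    · obtain ⟨γ', hγ', hγ'σ⟩ := exists_moebiusMaps_inversion (F := F) v x₀ hr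
      refine ⟨γ ∘ γ', comp_mem_moebiusMaps hγ hγ', ?_⟩
      filter_upwards [hev] with z ⟨hzU, hzτ⟩
      have hzx₀ : φ i z ≠ x₀ := fun h => hx₀ (h ▸ hzU)
      simp only [comp_apply]
      rw [← hγ'σ _ hzx₀, ← hγσ, ← hzτ, hinv hzU]

variable (F) in
/-- **Development of a simply connected conformally flat manifold** (Kuiper 1949, Theorem
p. 917; Benedetti–Petronio 1992, Prop. B.1.17 p. 55 applied to the `(Sⁿ, Möb(n))`-structure
`moebiusAtlas`): for `n ≥ 3`, a simply connected `n`-manifold with a locally conformally flat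
metric admits a `C^∞` local diffeomorphism into the sphere `Sⁿ ⊂ F` (`dim F = n + 1`), which
near every point is a conformally flat chart followed by the inverse stereographic projection
and a Möbius transformation (the developing map; its conformality is not recorded).
[cite: Kuiper1949, Theorem p. 917] [cite: BenedettiPetronio1992, Prop. B.1.17 p. 55] -/
theorem exists_developingMap (hn : 3 ≤ n) [SimplyConnectedSpace M]
    (hg : g.IsLocallyConformallyFlat) :
    ∃ dev : M → sphere (0 : F) 1, IsLocalDiffeomorph (𝓡 n) (𝓡 n) ∞ dev := by
  haveI : LocallyPathConnectedSpace M :=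
    ChartedSpace.locallyPathConnectedSpace (EuclideanSpace ℝ (Fin n)) M
  haveI : Nonempty (sphere (0 : F) 1) := by
    haveI : FiniteDimensional ℝ F := .of_fact_finrank_eq_succ n
    haveI : Nontrivial F := Module.nontrivial_of_finrank_pos (R := ℝ)
      (by rw [Fact.out (p := finrank ℝ F = n + 1)]; omega)
    exact (NormedSpace.sphere_nonempty.2 zero_le_one).to_subtype
  obtain ⟨v⟩ := ‹Nonempty (sphere (0 : F) 1)›
  have hg' : ∀ x : M, ∃ (φ : M → EuclideanSpace ℝ (Fin n)) (u : M → ℝ),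
      g.IsConformallyFlatIn x φ u := hg
  choose φ u hφ using hg'
  -- the `(Sⁿ, Möb)`-atlas and its developing map
  set At := moebiusAtlas hn v φ u hφ with hAt
  have hrig : Manifold.GStructure.Atlas.Rigid (moebiusMaps F) := fun g₁ hg₁ g₂ hg₂ p hp =>
    moebiusMaps_rigid (n := n) (by omega) hg₁ hg₂ hp
  have hcc : Manifold.GStructure.Atlas.CompClosed (moebiusMaps F) := fun g₁ hg₁ g₂ hg₂ =>
    comp_mem_moebiusMaps hg₁ hg₂
  obtain ⟨D, hD⟩ := At.exists_developingMap' hrig hcc ⟨id, id_mem_moebiusMaps⟩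
  -- `D` is a local diffeomorphism: near `x` it is `γ ∘ σ⁻¹ ∘ φ i`
  refine ⟨D, fun x => ?_⟩
  obtain ⟨i, γ, hxi, hγ, hDx⟩ := hD x
  obtain ⟨Φ, hΦ⟩ := exists_diffeomorph_of_mem_moebiusMaps (n := n) hγ
  have h1 : IsLocalDiffeomorphAt (𝓡 n) 𝓘(ℝ, EuclideanSpace ℝ (Fin n)) ∞ (φ i) x := hxi.1
  have h2 := (h1.comp (hg := isLocalDiffeomorphAt_stereographic'_symm v (φ i x))).comp
    (hg := Φ.isLocalDiffeomorph _)
  refine isLocalDiffeomorphAt_congr_of_eventuallyEq h2 ?_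
  rw [hΦ]
  exact hDx

end Development

/-! ### Kuiper's theorem -/

/-- **Kuiper's development theorem, proved**: the named fact `kuiper_developingMap` holds — a
simply connected smooth `n`-manifold (`n ≥ 3`) with a locally conformally flat Riemannian metric
admits a `C^∞` local diffeomorphism into the round sphere `Sⁿ ⊂ ℝⁿ⁺¹` (`exists_developingMap`
for `F = ℝⁿ⁺¹`; Liouville's theorem + Möbius rigidity + monodromy).
[cite: Kuiper1949, Theorem p. 917] -/
theorem kuiper_developingMap_holds : kuiper_developingMap := by
  intro n hn M _ _ _ _ _ _ hg
  obtain ⟨g, -, hcf⟩ := hg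
  haveI : Fact (finrank ℝ (EuclideanSpace ℝ (Fin (n + 1))) = n + 1) :=
    ⟨finrank_euclideanSpace_fin⟩
  exact exists_developingMap (EuclideanSpace ℝ (Fin (n + 1))) hn hcf

/-- **Kuiper's theorem (Kuiper 1949, Theorem p. 917; Besse 1987, Thm. 1.171), proved**: the
named fact `Literature.Geometry.Riemannian.kuiper` holds — a compact simply connected smooth `n`-manifold,
`n ≥ 3`, with a locally conformally flat Riemannian metric is diffeomorphic to `Sⁿ`
(`kuiper_of_developingMap` applied to `kuiper_developingMap_holds`).
[cite: Kuiper1949, Theorem p. 917] [cite: Besse1987, Thm. 1.171] -/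
theorem kuiper_holds : kuiper :=
  kuiper_of_developingMap kuiper_developingMap_holds

end Literature.Geometry.Riemannian

namespace Literature.Geometry.Riemannian

/-- **Kuiper's theorem in dimension four, proved**: the named fact
`kuiper_conformallyFlat_sphere_four` (`PICSphereFacts.lean`) holds — a compact simply
connected smooth 4-manifold with a locally conformally flat Riemannian metric is diffeomorphic
to `S⁴` (the case `n = 4` of `Literature.Geometry.Riemannian.kuiper_holds`).
[cite: Kuiper1949, Theorem p. 917] [cite: Besse1987, Thm. 1.171] -/
theorem kuiper_conformallyFlat_sphere_four_holds : kuiper_conformallyFlat_sphere_four :=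
  kuiper_conformallyFlat_sphere_four_of_kuiper Literature.Geometry.Riemannian.kuiper_holds

end Literature.Geometry.Riemannian

end
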